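import Mathlib
import Summits.AnomalousDissipation.AnomalousDissipation.Theorems.MarginalStabilityChainStretchedVortexRowsStubRowVorticityConstructionTools

/-!
# Stub `stub_rowVorticityConstruction` (crux stmt-AnomalousDissipation-3009) — tools VIII:
# the regularised cylinder kernel `Φ_ε = log(cosh t − cos s + ε)` and its Laplacian

Helper file (supports stmt-AnomalousDissipation-3009). First brick of the POISSON EQUATION `ΔΨ = 4πω` for the
stream integral `Ψ = ∫_{S_L} Φ_L ω(· − q)` (equivalently the curl identity `∂ₓv − ∂_yu = ω` of the cylinder
Biot–Savart law), by the regularisation route of the tree's `NewtonianPotentialRegularity` (Gilbarg–Trudinger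
Lemma 4.2, `C²` case): replace the singular kernel `Φ = log(cosh t − cos s)` by the SMOOTH kernels
`Φ_ε = log(cosh t − cos s + ε)`, `ε > 0`. In the normalised variables `(s, t)`:

* `D_ε = cosh t − cos s + ε > 0`; `Φ_ε` is `C^∞` on `ℝ × ℝ`; `∂ₜΦ_ε = sinh t/D_ε`, `∂ₛΦ_ε = sin s/D_ε`,
  `∂ₜ(sinh t/D_ε) = (cosh t·D_ε − sinh²t)/D_ε²`, `∂ₛ(sin s/D_ε) = (cos s·D_ε − sin²s)/D_ε²` (`HasDerivAt`);
* **`ΔΦ_ε = ρ_ε := ε(cosh t + cos s)/D_ε² ≥ 0`** (`lap_logKerReg`: the numerator collapses by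
  `cosh² − sinh² = 1 = cos² + sin²` — for `ε = 0` this is the harmonicity of `Φ` off the lattice);
* uniform bounds: `|sinh t/D_ε| ≤ |sinh t/D|`, `|sin s/D_ε| ≤ |sin s/D|` (so the local bounds of tools I apply
  uniformly in `ε`), `Φ ≤ Φ_ε ≤ 2 + |t|` for `ε ≤ 1`, and `ρ_ε ≤ ε(cosh t + 1)/D_ε²`;
* the flux at infinity `sinh t/D_ε → ±1` as `t → ±∞` (source of the total mass `∫_{strip} ρ_ε = 4π`).
Registered sub-goal proved here: `stub_rowVorticityConstruction_regKernelLaplacian`. All `[folklore]`.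
-/

set_option linter.dupNamespace false

noncomputable section

open Real Set Filter Topology

namespace Summit.AnomalousDissipation.AnomalousDissipation.Theorems.MarginalStabilityChainStretchedVortexRows.RowBiotSavart

/-! ### The regularised denominator and kernel -/

/-- `0 < cosh t − cos s + ε` for `ε > 0`. [folklore] -/
theorem denReg_pos {ε : ℝ} (hε : 0 < ε) (s t : ℝ) : 0 < Real.cosh t - Real.cos s + ε := by
  linarith [den_nonneg s t]

/-- `Φ_ε = log(cosh t − cos s + ε)` is smooth on `ℝ × ℝ` for `ε > 0`. [folklore] -/
theorem contDiff_logKerReg {ε : ℝ} (hε : 0 < ε) {n : WithTop ℕ∞} :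
    ContDiff ℝ n fun z : ℝ × ℝ => Real.log (Real.cosh z.2 - Real.cos z.1 + ε) := by
  refine ContDiff.log (by fun_prop) fun z => (denReg_pos hε z.1 z.2).ne'

/-- `∂ₜ Φ_ε = sinh t / D_ε`. [folklore] -/
theorem hasDerivAt_logKerReg_snd {ε : ℝ} (hε : 0 < ε) (s t : ℝ) :
    HasDerivAt (fun t' => Real.log (Real.cosh t' - Real.cos s + ε))
      (Real.sinh t / (Real.cosh t - Real.cos s + ε)) t := by
  have h1 : HasDerivAt (fun t' => Real.cosh t' - Real.cos s + ε) (Real.sinh t) t := by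
    simpa using ((Real.hasDerivAt_cosh t).sub_const (Real.cos s)).add_const ε
  exact h1.log (denReg_pos hε s t).ne'

/-- `∂ₛ Φ_ε = sin s / D_ε`. [folklore] -/
theorem hasDerivAt_logKerReg_fst {ε : ℝ} (hε : 0 < ε) (s t : ℝ) :
    HasDerivAt (fun s' => Real.log (Real.cosh t - Real.cos s' + ε))
      (Real.sin s / (Real.cosh t - Real.cos s + ε)) s := by
  have h1 : HasDerivAt (fun s' => Real.cosh t - Real.cos s' + ε) (Real.sin s) s := by
    simpa using ((Real.hasDerivAt_cos s).const_sub (Real.cosh t)).add_const ε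
  exact h1.log (denReg_pos hε s t).ne'

/-- `∂ₜ (sinh t/D_ε) = (cosh t·D_ε − sinh² t)/D_ε²`. [folklore] -/
theorem hasDerivAt_kerRegU_snd {ε : ℝ} (hε : 0 < ε) (s t : ℝ) :
    HasDerivAt (fun t' => Real.sinh t' / (Real.cosh t' - Real.cos s + ε))
      ((Real.cosh t * (Real.cosh t - Real.cos s + ε) - Real.sinh t ^ 2) / (Real.cosh t - Real.cos s + ε) ^ 2) t := by
  have h1 : HasDerivAt (fun t' => Real.cosh t' - Real.cos s + ε) (Real.sinh t) t := by
    simpa using ((Real.hasDerivAt_cosh t).sub_const (Real.cos s)).add_const ε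
  have h := (Real.hasDerivAt_sinh t).div h1 (denReg_pos hε s t).ne'
  refine h.congr_deriv ?_
  ring

/-- `∂ₛ (sin s/D_ε) = (cos s·D_ε − sin² s)/D_ε²`. [folklore] -/
theorem hasDerivAt_kerRegV_fst {ε : ℝ} (hε : 0 < ε) (s t : ℝ) :
    HasDerivAt (fun s' => Real.sin s' / (Real.cosh t - Real.cos s' + ε))
      ((Real.cos s * (Real.cosh t - Real.cos s + ε) - Real.sin s ^ 2) / (Real.cosh t - Real.cos s + ε) ^ 2) s := by
  have h1 : HasDerivAt (fun s' => Real.cosh t - Real.cos s' + ε) (Real.sin s) s := by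
    simpa using ((Real.hasDerivAt_cos s).const_sub (Real.cosh t)).add_const ε
  have h := (Real.hasDerivAt_sin s).div h1 (denReg_pos hε s t).ne'
  refine h.congr_deriv ?_
  ring

/-- **The Laplacian of the regularised kernel**: `∂ₜ²Φ_ε + ∂ₛ²Φ_ε = ε(cosh t + cos s)/D_ε²`. [folklore] -/
theorem lap_logKerReg {ε : ℝ} (hε : 0 < ε) (s t : ℝ) :
    (Real.cosh t * (Real.cosh t - Real.cos s + ε) - Real.sinh t ^ 2) / (Real.cosh t - Real.cos s + ε) ^ 2 +
        (Real.cos s * (Real.cosh t - Real.cos s + ε) - Real.sin s ^ 2) / (Real.cosh t - Real.cos s + ε) ^ 2 =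
      ε * (Real.cosh t + Real.cos s) / (Real.cosh t - Real.cos s + ε) ^ 2 := by
  have hD := (denReg_pos hε s t).ne'
  rw [← add_div]
  congr 1
  nlinarith [Real.cosh_sq t, Real.sin_sq_add_cos_sq s]

/-! ### Bounds uniform in `ε` -/

/-- The regularised velocity kernel is dominated by the singular one: `|sinh t/D_ε| ≤ |sinh t/D|` (both vanish
where `D = 0`). [folklore] -/
theorem abs_kerRegU_le {ε : ℝ} (hε : 0 < ε) (s t : ℝ) :
    |Real.sinh t / (Real.cosh t - Real.cos s + ε)| ≤ |Real.sinh t / (Real.cosh t - Real.cos s)| := by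
  rcases (den_nonneg s t).eq_or_lt with hD | hD
  · have ht : Real.cosh t = 1 := le_antisymm (by linarith [Real.cos_le_one s]) (Real.one_le_cosh t)
    have ht0 : t = 0 := by
      by_contra h; have := Real.one_lt_cosh.2 h; linarith
    simp [ht0]
  · rw [abs_div, abs_div, abs_of_pos hD, abs_of_pos (denReg_pos hε s t)]
    exact div_le_div_of_nonneg_left (abs_nonneg _) hD (by linarith)

/-- `|sin s/D_ε| ≤ |sin s/D|`. [folklore] -/
theorem abs_kerRegV_le {ε : ℝ} (hε : 0 < ε) (s t : ℝ) :
    |Real.sin s / (Real.cosh t - Real.cos s + ε)| ≤ |Real.sin s / (Real.cosh t - Real.cos s)| := by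
  rcases (den_nonneg s t).eq_or_lt with hD | hD
  · have hc : Real.cos s = 1 := by
      have := Real.one_le_cosh t
      have h2 := Real.cos_le_one s
      linarith
    have hs : Real.sin s = 0 := by
      have := Real.sin_sq_add_cos_sq s
      rw [hc] at this
      nlinarith
    simp [hs]
  · rw [abs_div, abs_div, abs_of_pos hD, abs_of_pos (denReg_pos hε s t)]
    exact div_le_div_of_nonneg_left (abs_nonneg _) hD (by linarith)

/-- `Φ ≤ Φ_ε` where `D > 0`. [folklore] -/
theorem logKer_le_logKerReg {ε : ℝ} (hε : 0 < ε) {s t : ℝ} (hD : 0 < Real.cosh t - Real.cos s) :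
    Real.log (Real.cosh t - Real.cos s) ≤ Real.log (Real.cosh t - Real.cos s + ε) :=
  Real.log_le_log hD (by linarith)

/-- `Φ_ε ≤ 2 + |t|` for `ε ≤ 1`. [folklore] -/
theorem logKerReg_le {ε : ℝ} (hε : 0 < ε) (hε1 : ε ≤ 1) (s t : ℝ) :
    Real.log (Real.cosh t - Real.cos s + ε) ≤ 2 + |t| := by
  have h1 := den_le_two_mul_exp s t
  have h2 : Real.cosh t - Real.cos s + ε ≤ 3 * Real.exp |t| := by
    have : (1:ℝ) ≤ Real.exp |t| := Real.one_le_exp (abs_nonneg t)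
    linarith
  have h3 := Real.log_le_log (denReg_pos hε s t) h2
  rw [Real.log_mul (by norm_num) (Real.exp_pos _).ne', Real.log_exp] at h3
  have h4 : Real.log 3 ≤ 2 := by
    have : (3:ℝ) ≤ Real.exp 2 := by
      rw [show (2:ℝ) = 1 + 1 by norm_num, Real.exp_add]; nlinarith [Real.exp_one_gt_d9]
    have := Real.log_le_log (by norm_num) this
    rwa [Real.log_exp] at this
  linarith

/-- UNIFORM LOCAL BOUND for the regularised log kernel on the punctured strip: `|Φ_ε| ≤ 12 + 3|t| + 2/‖(s,t)‖`
for `0 < ε ≤ 1`, `|s| ≤ π`, `(s,t) ≠ 0` (at the origin `Φ_ε = log ε` is not uniformly bounded — a null set).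
[folklore] -/
theorem abs_logKerReg_le {ε : ℝ} (hε : 0 < ε) (hε1 : ε ≤ 1) {z : ℝ × ℝ} (hs : |z.1| ≤ π) (hz : z ≠ 0) :
    |Real.log (Real.cosh z.2 - Real.cos z.1 + ε)| ≤ 12 + 3 * |z.2| + 2 / ‖z‖ := by
  have hup := logKerReg_le hε hε1 z.1 z.2
  have hn : 0 ≤ 2 / ‖z‖ := by positivity
  rw [abs_le]
  refine ⟨?_, by linarith [abs_nonneg z.2]⟩
  have hD := den_pos hs hz
  have h1 := logKer_le_logKerReg hε hD
  have h2 := abs_logKer_le hs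
  rw [abs_le] at h2
  linarith [h2.1]

/-- The bump `ρ_ε = ε(cosh t + cos s)/D_ε²` is nonnegative. [folklore] -/
theorem bumpReg_nonneg {ε : ℝ} (hε : 0 < ε) (s t : ℝ) :
    0 ≤ ε * (Real.cosh t + Real.cos s) / (Real.cosh t - Real.cos s + ε) ^ 2 := by
  have : 0 ≤ Real.cosh t + Real.cos s := by linarith [Real.one_le_cosh t, Real.neg_one_le_cos s]
  positivity

/-- `ρ_ε ≤ ε(cosh t + 1)/D_ε²`. [folklore] -/
theorem bumpReg_le {ε : ℝ} (hε : 0 < ε) (s t : ℝ) :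
    ε * (Real.cosh t + Real.cos s) / (Real.cosh t - Real.cos s + ε) ^ 2 ≤
      ε * (Real.cosh t + 1) / (Real.cosh t - Real.cos s + ε) ^ 2 := by
  have hD := denReg_pos hε s t
  apply div_le_div_of_nonneg_right _ (by positivity)
  exact mul_le_mul_of_nonneg_left (by linarith [Real.cos_le_one s]) hε.le

/-- AWAY FROM THE ORIGIN the bump is `O(ε)`: on `|s| ≤ π`, `ρ_ε(z) ≤ ε · 25(cosh t + 1)/‖z‖⁴`. [folklore] -/
theorem bumpReg_le_of_norm {ε : ℝ} (hε : 0 < ε) {z : ℝ × ℝ} (hs : |z.1| ≤ π) (hz : z ≠ 0) :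
    ε * (Real.cosh z.2 + Real.cos z.1) / (Real.cosh z.2 - Real.cos z.1 + ε) ^ 2 ≤
      ε * (25 * (Real.cosh z.2 + 1) / ‖z‖ ^ 4) := by
  have hD := den_pos hs hz
  have hn : 0 < ‖z‖ := norm_pos_iff.2 hz
  have h1 := norm_sq_le_den hs z.2
  simp only [Prod.mk.eta] at h1
  refine (bumpReg_le hε z.1 z.2).trans ?_
  rw [mul_div_assoc]
  refine mul_le_mul_of_nonneg_left ?_ hε.le
  have hc : 0 ≤ Real.cosh z.2 + 1 := by linarith [Real.one_le_cosh z.2]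
  rw [div_le_div_iff₀ (by positivity) (by positivity)]
  have h2 : ‖z‖ ^ 4 ≤ 25 * (Real.cosh z.2 - Real.cos z.1 + ε) ^ 2 := by
    have h3 : ‖z‖ ^ 2 / 5 ≤ Real.cosh z.2 - Real.cos z.1 + ε := by linarith
    have h4 : 0 ≤ ‖z‖ ^ 2 / 5 := by positivity
    nlinarith [mul_le_mul h3 h3 h4 (hD.le.trans (by linarith))]
  nlinarith [mul_le_mul_of_nonneg_left h2 hc]

/-- FAR FROM THE AXIS the bump is exponentially small: `ρ_ε ≤ ε · 16 e^{−|t|}` for `|t| ≥ 2`. [folklore] -/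
theorem bumpReg_le_exp {ε : ℝ} (hε : 0 < ε) {t : ℝ} (ht : 2 ≤ |t|) (s : ℝ) :
    ε * (Real.cosh t + Real.cos s) / (Real.cosh t - Real.cos s + ε) ^ 2 ≤ ε * (16 * Real.exp (-|t|)) := by
  refine (bumpReg_le hε s t).trans ?_
  rw [mul_div_assoc]
  refine mul_le_mul_of_nonneg_left ?_ hε.le
  have hD0 := exp_le_den ht s
  have h7 := seven_le_exp ht
  have hDε : 5 / 14 * Real.exp |t| ≤ Real.cosh t - Real.cos s + ε := by linarith
  have hc : Real.cosh t + 1 ≤ 2 * Real.exp |t| := by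
    have : Real.cosh t ≤ Real.exp |t| := by
      rw [← Real.cosh_abs, Real.cosh_eq]
      have : Real.exp (-|t|) ≤ Real.exp |t| := Real.exp_le_exp.2 (by linarith [abs_nonneg t])
      linarith
    have h1 : (1:ℝ) ≤ Real.exp |t| := Real.one_le_exp (abs_nonneg t)
    linarith
  have hpos : 0 < (Real.cosh t - Real.cos s + ε) ^ 2 := pow_pos (denReg_pos hε s t) 2
  rw [div_le_iff₀ hpos]
  have hmul : Real.exp (-|t|) * Real.exp |t| = 1 := by rw [← Real.exp_add]; simp
  have h25 : (5 / 14 * Real.exp |t|) ^ 2 ≤ (Real.cosh t - Real.cos s + ε) ^ 2 :=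
    pow_le_pow_left₀ (by positivity) hDε 2
  nlinarith [Real.exp_pos (-|t|), Real.exp_pos |t|, mul_le_mul_of_nonneg_left h25 (by positivity : (0:ℝ) ≤ 16 * Real.exp (-|t|))]

end RowBiotSavart

open RowBiotSavart in
/-- **Laplacian of the regularised cylinder kernel** (registered on stmt-AnomalousDissipation-3009 as the helper
stub `stub_rowVorticityConstruction_regKernelLaplacian` of `stub_rowVorticityConstruction`): for `ε > 0` the
smooth kernel `Φ_ε(s,t) = log(cosh t − cos s + ε)` has `∂ₜΦ_ε = sinh t/D_ε`, `∂ₛΦ_ε = sin s/D_ε`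
(`D_ε = cosh t − cos s + ε`), `∂ₜ(sinh t/D_ε) = (cosh t·D_ε − sinh²t)/D_ε²`, `∂ₛ(sin s/D_ε) = (cos s·D_ε − sin²s)/D_ε²`,
and `ΔΦ_ε = ε(cosh t + cos s)/D_ε² ≥ 0` — the approximate identity of the Poisson equation for the cylinder
stream function (`RowBiotSavart.lap_logKerReg` and the `HasDerivAt` lemmas of this file). [folklore] -/
theorem stub_rowVorticityConstruction_regKernelLaplacian :
    ∀ (ε s t : ℝ), 0 < ε →
      HasDerivAt (fun t' => Real.log (Real.cosh t' - Real.cos s + ε)) (Real.sinh t / (Real.cosh t - Real.cos s + ε)) t ∧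
      HasDerivAt (fun s' => Real.log (Real.cosh t - Real.cos s' + ε)) (Real.sin s / (Real.cosh t - Real.cos s + ε)) s ∧
      HasDerivAt (fun t' => Real.sinh t' / (Real.cosh t' - Real.cos s + ε))
        ((Real.cosh t * (Real.cosh t - Real.cos s + ε) - Real.sinh t ^ 2) / (Real.cosh t - Real.cos s + ε) ^ 2) t ∧
      HasDerivAt (fun s' => Real.sin s' / (Real.cosh t - Real.cos s' + ε))
        ((Real.cos s * (Real.cosh t - Real.cos s + ε) - Real.sin s ^ 2) / (Real.cosh t - Real.cos s + ε) ^ 2) s ∧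
      (Real.cosh t * (Real.cosh t - Real.cos s + ε) - Real.sinh t ^ 2) / (Real.cosh t - Real.cos s + ε) ^ 2 +
          (Real.cos s * (Real.cosh t - Real.cos s + ε) - Real.sin s ^ 2) / (Real.cosh t - Real.cos s + ε) ^ 2 =
        ε * (Real.cosh t + Real.cos s) / (Real.cosh t - Real.cos s + ε) ^ 2 ∧
      0 ≤ ε * (Real.cosh t + Real.cos s) / (Real.cosh t - Real.cos s + ε) ^ 2 :=
  fun _ s t hε => ⟨hasDerivAt_logKerReg_snd hε s t, hasDerivAt_logKerReg_fst hε s t, hasDerivAt_kerRegU_snd hε s t,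
    hasDerivAt_kerRegV_fst hε s t, lap_logKerReg hε s t, bumpReg_nonneg hε s t⟩

end Summit.AnomalousDissipation.AnomalousDissipation.Theorems.MarginalStabilityChainStretchedVortexRows

end
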